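import Summits.QuantumFields.YangMills.Theorems.ParabolicTrajectoryLatticeGapOnTrajectoryTransferFromOSGapSlack
import Summits.QuantumFields.YangMills.Theorems.LatticeGapOnTrajectory.Negative.ZeroCoupling
import HarnessLib

/-!
# Crux `LatticeGapOnTrajectory` (stmt-QuantumFields-10523), line `orbit-kantorovich-finite-size`:
# non-vacuity of the transfer hypotheses at zero coupling (A4)

Helper file (`--supports stmt-QuantumFields-10523`). Sanity check of the repaired transfer
hypothesis `TorusOSGapSlack` (`…TransferFromOSGapSlack`) and of its idealisation `TorusOSGap`
(`…TransferFromOSGap`): along any scheme with ZERO COUPLING (`β_k = 0` for all `k`) both hold for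
every rate `Δ`, the former with slack `0`, because every OS-type connected correlation vanishes
identically.

At `β = 0` Wilson's torus measure is the product Haar measure (`wilsonMeasure_zero_coupling`).
An observable `X` depending on the links based at lattice times `1 … w` has its site-reflected
copy `X ∘ Θ'` depending on the links at times `L_k + 1 … 2L_k` (i.e. `−L_k … −1`) as soon as
`2w ≤ L_k`, and its translate `X ∘ τ_m` depending on the links at times `1 … L_k` as soon as
`m + w ≤ L_k`; these two half-spaces of links are disjoint, so under the product measure
`∫ conj X(Θ'U) · X(τ_m U) = conj(∫ X∘Θ') · ∫ X∘τ_m = conj(∫ X) · ∫ X` (reflection and translation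
invariance), i.e. `corr_k(X; m) = 0` for every `m` with `m + 2w ≤ L_k`, including `m = 0`. Both
sides of the defining inequalities are then `0`.

* `integral_mul_eq_of_dependsOn_disjoint_complex`: complex-valued ultralocality of a product
  probability measure (functions of disjoint coordinate sets are uncorrelated);
* `dependsOn_comp_negReflect_of_slab`, `dependsOn_comp_torusTimeShift_of_slab`: the supports of
  `X ∘ Θ'` and `X ∘ τ_m`;
* `integral_conj_negReflect_mul_shift_of_zero_coupling`: `corr_k(X; m) = 0` at `β_k = 0`;
* `torusOSGapSlack_of_zero_coupling`, `torusOSGap_of_zero_coupling`: the non-vacuity statements.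

References: Osterwalder–Seiler 1978 §2 (site reflection, time translations on the periodic
lattice); Glimm–Jaffe 1987 §6.1.
-/

open scoped ComplexConjugate
open Filter Set MeasureTheory ProbabilityTheory
open Literature.MathematicalPhysics.QuantumLattice
open Literature.MathematicalPhysics.QuantumFieldTheory
open Summit.QuantumFields.YangMills.Theorems.LatticeGapOnTrajectory.Negative
  (wilsonMeasure_zero_coupling)

noncomputable section

namespace Summit.QuantumFields.YangMills.Cruxes.LatticeGapOnTrajectory.OrbitKantorovichFiniteSize

namespace Transfer

/-! ## §1 Ultralocality of a product measure, complex-valued -/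

/-- **Ultralocality of a product measure (complex-valued).** Under a product probability measure,
measurable complex functions depending on DISJOINT sets of coordinates are uncorrelated:
`∫ f g = ∫ f · ∫ g` (Mathlib `iIndepFun_pi`; the real-valued version is
`integral_mul_eq_of_dependsOn_disjoint` of `…Negative.ZeroCoupling`). [folklore] -/
theorem integral_mul_eq_of_dependsOn_disjoint_complex {κ H : Type*} [Fintype κ] [One H]
    [MeasurableSpace H] (ν : Measure H) [IsProbabilityMeasure ν] {f g : (κ → H) → ℂ}
    {I J : Set κ} (hIJ : Disjoint I J) (hf : DependsOn f I) (hg : DependsOn g J)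
    (hfm : Measurable f) (hgm : Measurable g) :
    ∫ U, f U * g U ∂(Measure.pi fun _ : κ => ν) =
      (∫ U, f U ∂(Measure.pi fun _ : κ => ν)) * ∫ U, g U ∂(Measure.pi fun _ : κ => ν) := by
  -- adapted from `…Negative.ZeroCoupling` (`integral_mul_eq_of_dependsOn_disjoint`)
  classical
  -- measurable sections ("pad by 1") of the two restriction maps
  have hpad : ∀ K : Set κ, ∃ pad : (↥K.toFinset → H) → κ → H,
      Measurable pad ∧ ∀ U : κ → H, ∀ e ∈ K, pad (fun i : ↥K.toFinset => U i) e = U e := by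
    intro K
    refine ⟨fun u e => if h : e ∈ K then u ⟨e, Set.mem_toFinset.2 h⟩ else 1, ?_, ?_⟩
    · refine measurable_pi_lambda _ fun e => ?_
      by_cases he : e ∈ K
      · simp only [he, dite_true]; exact measurable_pi_apply _
      · simp only [he, dite_false]; exact measurable_const
    · intro U e he
      simp [he]
  obtain ⟨padI, hmI, hI⟩ := hpad I
  obtain ⟨padJ, hmJ, hJ⟩ := hpad J
  have hind : iIndepFun (fun (e : κ) (U : κ → H) => U e) (Measure.pi fun _ : κ => ν) :=
    iIndepFun_pi (X := fun _ : κ => @id H) fun _ => aemeasurable_id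
  have hIJ' : IndepFun (fun (U : κ → H) (i : ↥I.toFinset) => U i)
      (fun (U : κ → H) (j : ↥J.toFinset) => U j) (Measure.pi fun _ : κ => ν) :=
    hind.indepFun_finset I.toFinset J.toFinset (Set.disjoint_toFinset.2 hIJ)
      fun e => measurable_pi_apply e
  have hcomp : IndepFun ((f ∘ padI) ∘ fun (U : κ → H) (i : ↥I.toFinset) => U i)
      ((g ∘ padJ) ∘ fun (U : κ → H) (j : ↥J.toFinset) => U j) (Measure.pi fun _ : κ => ν) :=
    hIJ'.comp (hfm.comp hmI) (hgm.comp hmJ)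
  have hf' : ((f ∘ padI) ∘ fun (U : κ → H) (i : ↥I.toFinset) => U i) = f := by
    funext U; exact hf (hI U)
  have hg' : ((g ∘ padJ) ∘ fun (U : κ → H) (j : ↥J.toFinset) => U j) = g := by
    funext U; exact hg (hJ U)
  rw [hf', hg'] at hcomp
  exact hcomp.integral_fun_mul_eq_mul_integral hfm.aestronglyMeasurable hgm.aestronglyMeasurable

/-! ## §2 Supports of the reflected and of the translated observable -/

variable {G : Type} [Group G] [TopologicalSpace G] [IsTopologicalGroup G] [CompactSpace G]
  [MeasurableSpace G] [BorelSpace G]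

omit [TopologicalSpace G] [IsTopologicalGroup G] [CompactSpace G] [MeasurableSpace G]
  [BorelSpace G] in
/-- **Support of the reflected observable.** On the torus of side `2L_k + 1`, if `X` depends only
on the links based at lattice times `1 … w` with `2w ≤ L_k`, then `U ↦ X(Θ'U)` depends only on the
links based at lattice times `L_k + 1 … 2L_k` (the images `−t` of spatial links at time `t` have
time `2L_k + 1 − t ≥ L_k + 1`, the reversed temporal links have time `2L_k − t ≥ L_k + 1` as
`t ≤ w ≤ L_k − 1` once `w ≥ 1`). [cite: OsterwalderSeiler1978, §2] -/
theorem dependsOn_comp_negReflect_of_slab {ι : Type} (sch : SpeciesScheme ι) (k : ℕ) {w : ℕ}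
    (hw : 2 * w ≤ sch.L k) {α : Type*} {X : GaugeConfig 4 (sch.side k) G → α}
    (hX : DependsOn X {e : Edge 4 (sch.side k) | 1 ≤ (e.1 0).val ∧ (e.1 0).val ≤ w}) :
    DependsOn (fun U : GaugeConfig 4 (sch.side k) G => X U.negReflect)
      {e : Edge 4 (sch.side k) | sch.L k + 1 ≤ (e.1 0).val} := by
  have hS : sch.side k = 2 * sch.L k + 1 := rfl
  intro U V hUV
  refine hX fun e he => ?_
  obtain ⟨x, i⟩ := e
  obtain ⟨h1, h2⟩ := he
  simp only at h1 h2
  unfold GaugeConfig.negReflect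
  by_cases hi : i = 0
  · simp only [hi, if_true]
    rw [hUV _ ?_]
    simp only [Set.mem_setOf_eq, WilsonSiteRP.negReflect_apply_zero, WilsonRP.shift_apply_self]
    have hx : x 0 + 1 = (((x 0).val + 1 : ℕ) : ZMod (sch.side k)) := by
      rw [Nat.cast_succ, ZMod.natCast_zmod_val]
    have ht : (x 0).val + 1 < sch.side k := by omega
    have e1 : ((x 0).val + 1) % sch.side k = (x 0).val + 1 := Nat.mod_eq_of_lt ht
    have e2 : (sch.side k - ((x 0).val + 1)) % sch.side k = sch.side k - ((x 0).val + 1) :=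
      Nat.mod_eq_of_lt (by omega)
    rw [hx, ZMod.neg_val', ZMod.val_natCast, e1, e2]
    omega
  · simp only [hi, if_false]
    rw [hUV _ ?_]
    simp only [Set.mem_setOf_eq]
    rw [WilsonSiteRP.val_negReflect, if_neg (by omega)]
    omega

omit [Group G] [TopologicalSpace G] [IsTopologicalGroup G] [CompactSpace G] [BorelSpace G] in
/-- **Support of the translated observable.** If `X` depends only on the links based at lattice
times `1 … w` and `m + w ≤ L_k`, then `U ↦ X(τ_m U)` depends only on the links based at lattice
times `1 … L_k` (`(τ_m U)(x, i) = U(x + m e₀, i)`, no wrap-around).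
[cite: OsterwalderSeiler1978, §2] -/
theorem dependsOn_comp_torusTimeShift_of_slab {ι : Type} (sch : SpeciesScheme ι) (k : ℕ)
    {w m : ℕ} (hm : m + w ≤ sch.L k) {α : Type*} {X : GaugeConfig 4 (sch.side k) G → α}
    (hX : DependsOn X {e : Edge 4 (sch.side k) | 1 ≤ (e.1 0).val ∧ (e.1 0).val ≤ w}) :
    DependsOn (fun U : GaugeConfig 4 (sch.side k) G => X (torusTimeShift (sch.side k) m U))
      {e : Edge 4 (sch.side k) | 1 ≤ (e.1 0).val ∧ (e.1 0).val ≤ sch.L k} := by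
  have hS : sch.side k = 2 * sch.L k + 1 := rfl
  intro U V hUV
  refine hX fun e he => ?_
  obtain ⟨h1, h2⟩ := he
  simp only [torusTimeShift, torusConfigShift_apply]
  refine hUV _ ?_
  have h0 : (e.1 - Literature.Probability.LatticeModels.Torus.proj (sch.side k)
      (-(Pi.single 0 (m : ℤ) : Literature.Probability.LatticeModels.Site 4))) 0 =
        e.1 0 + (m : ZMod (sch.side k)) := by
    simp [Literature.Probability.LatticeModels.Torus.proj_apply, sub_neg_eq_add]
  have hval : (e.1 0 + (m : ZMod (sch.side k))).val = (e.1 0).val + m := by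
    rw [ZMod.val_add, ZMod.val_natCast, Nat.mod_eq_of_lt (show m < sch.side k by omega),
      Nat.mod_eq_of_lt (by omega)]
  simp only [Set.mem_setOf_eq, h0, hval]
  omega

/-! ## §3 At zero coupling every OS-type connected correlation vanishes -/

/-- **Zero coupling: `corr_k(X; m) = 0`.** At `β_k = 0`, for a measurable `X` on the torus of
side `2L_k + 1` depending only on the links at lattice times `1 … w` and `m + 2w ≤ L_k`,
`∫ conj X(Θ'U) · X(τ_m U) dμ_k = conj(∫ X dμ_k) · ∫ X dμ_k`: product Haar measure
(`wilsonMeasure_zero_coupling`), disjoint supports (§2), ultralocality (§1), and the invariance of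
`μ_k` under `Θ'` (`integral_comp_negReflect_eq`) and `τ_m` (`wilsonMeasure_map_torusConfigShift`).
[cite: OsterwalderSeiler1978, §2] -/
theorem integral_conj_negReflect_mul_shift_of_zero_coupling (r : LatticeRep G)
    (sch : SpeciesScheme (YMSpecies G)) (k : ℕ) (hβ : sch.β k = 0) {w m : ℕ}
    {X : GaugeConfig 4 (sch.side k) G → ℂ} (hX : Measurable X)
    (hdep : DependsOn X {e : Edge 4 (sch.side k) | 1 ≤ (e.1 0).val ∧ (e.1 0).val ≤ w})
    (hm : m + 2 * w ≤ sch.L k) :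
    ∫ U, conj (X U.negReflect) * X (torusTimeShift (sch.side k) m U)
        ∂(wilsonMeasure r.ρ (sch.β k)) =
      conj (∫ U, X U ∂(wilsonMeasure r.ρ (sch.β k))) * ∫ U, X U ∂(wilsonMeasure r.ρ (sch.β k)) := by
  -- the two factors and their supports
  have hA := dependsOn_comp_negReflect_of_slab (G := G) sch k (w := w) (by omega) hdep
  have hB := dependsOn_comp_torusTimeShift_of_slab (G := G) sch k (w := w) (m := m) (by omega) hdep
  have hA' : DependsOn (fun U : GaugeConfig 4 (sch.side k) G => conj (X U.negReflect))
      {e : Edge 4 (sch.side k) | sch.L k + 1 ≤ (e.1 0).val} := fun U V hUV =>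
    congrArg conj (hA hUV)
  have hdisj : Disjoint {e : Edge 4 (sch.side k) | sch.L k + 1 ≤ (e.1 0).val}
      {e : Edge 4 (sch.side k) | 1 ≤ (e.1 0).val ∧ (e.1 0).val ≤ sch.L k} :=
    Set.disjoint_left.2 fun e h1 h2 => by
      simp only [Set.mem_setOf_eq] at h1 h2
      omega
  have hmA : Measurable fun U : GaugeConfig 4 (sch.side k) G => conj (X U.negReflect) :=
    Complex.continuous_conj.measurable.comp (hX.comp WilsonSiteRP.measurable_negReflect)
  have hmB : Measurable fun U : GaugeConfig 4 (sch.side k) G =>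
      X (torusTimeShift (sch.side k) m U) := hX.comp (torusTimeShift _ _).measurable
  -- factorisation under the product Haar measure
  have h1 : ∫ U, conj (X U.negReflect) * X (torusTimeShift (sch.side k) m U)
        ∂(wilsonMeasure r.ρ (sch.β k)) =
      (∫ U, conj (X U.negReflect) ∂(wilsonMeasure r.ρ (sch.β k))) *
        ∫ U, X (torusTimeShift (sch.side k) m U) ∂(wilsonMeasure r.ρ (sch.β k)) := by
    rw [hβ, wilsonMeasure_zero_coupling]
    exact integral_mul_eq_of_dependsOn_disjoint_complex (haarProbability G) hdisj hA' hB hmA hmB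
  -- reflection invariance
  have h2 : ∫ U, conj (X U.negReflect) ∂(wilsonMeasure r.ρ (sch.β k)) =
      conj (∫ U, X U ∂(wilsonMeasure r.ρ (sch.β k))) := by
    rw [integral_conj]
    exact congrArg conj (integral_comp_negReflect_eq r.ρ r.continuous (sch.β k) X)
  -- translation invariance
  have h3 : ∫ U, X (torusTimeShift (sch.side k) m U) ∂(wilsonMeasure r.ρ (sch.β k)) =
      ∫ U, X U ∂(wilsonMeasure r.ρ (sch.β k)) := by
    have h := wilsonExpectation_comp_torusConfigShift (d := 4) (L := sch.side k) r.ρ (sch.β k)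
      (Literature.Probability.LatticeModels.Torus.proj (sch.side k)
        (-(Pi.single 0 (m : ℤ) : Literature.Probability.LatticeModels.Site 4))) X
    simpa only [wilsonExpectation, Function.comp_apply, torusTimeShift] using h
  rw [h1, h2, h3]

/-! ## §4 Non-vacuity of the transfer hypotheses at zero coupling -/

/-- **Non-vacuity of the repaired transfer hypothesis.** Along any scheme with zero coupling
(`β_k = 0` for all `k`) `TorusOSGapSlack r sch Δ 0` holds for every rate `Δ` (with `k₀ = 0`): both
the correlation at shift `m` and the OS variance term vanish identically
(`integral_conj_negReflect_mul_shift_of_zero_coupling` at `m` and at `0`), and the inequality reads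
`0 ≤ 0 · e^{−Δ a_k m} + 0 · B²`. [folklore] -/
theorem torusOSGapSlack_of_zero_coupling (r : LatticeRep G) (sch : SpeciesScheme (YMSpecies G))
    (hβ : ∀ k, sch.β k = 0) (Δ : ℝ) : TorusOSGapSlack r sch Δ 0 := by
  refine ⟨0, fun k _ w m X B hX _ hdep hm => ?_⟩
  have h1 := integral_conj_negReflect_mul_shift_of_zero_coupling r sch k (hβ k) hX hdep hm
  have h0 := integral_conj_negReflect_mul_shift_of_zero_coupling r sch k (hβ k) (m := 0) hX hdep
    (by omega)
  simp only [torusTimeShift_zero_apply] at h0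
  rw [h1, h0, sub_self, norm_zero, Complex.zero_re, zero_mul, Pi.zero_apply, zero_mul, add_zero]

/-- **Non-vacuity of the idealised transfer hypothesis.** Along any scheme with zero coupling
`TorusOSGap r sch Δ` holds for every rate `Δ`, for the same reason. [folklore] -/
theorem torusOSGap_of_zero_coupling (r : LatticeRep G) (sch : SpeciesScheme (YMSpecies G))
    (hβ : ∀ k, sch.β k = 0) (Δ : ℝ) : TorusOSGap r sch Δ := by
  refine ⟨0, fun k _ w m X hX _ hdep hm => ?_⟩
  have h1 := integral_conj_negReflect_mul_shift_of_zero_coupling r sch k (hβ k) hX hdep hm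
  have h0 := integral_conj_negReflect_mul_shift_of_zero_coupling r sch k (hβ k) (m := 0) hX hdep
    (by omega)
  simp only [torusTimeShift_zero_apply] at h0
  rw [h1, h0, sub_self, norm_zero, Complex.zero_re, zero_mul]

end Transfer

end Summit.QuantumFields.YangMills.Cruxes.LatticeGapOnTrajectory.OrbitKantorovichFiniteSize

end
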